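import Mathlib
import Literature.MathematicalPhysics.QuantumLattice.FermiRG.Salmhofer1998SkeletonInputs
import Literature.MathematicalPhysics.QuantumLattice.FermiRG.Salmhofer1998Lemma4Bounds
import Literature.Probability.Distributions.GaussianPiDensity
import HarnessLib

/-!
# Salmhofer 1998 Lemma 7: the elementary half — (o) and (6.8) — proved for the many-fermion propagator

Theorem-only companion of F7e `Salmhofer1998Sec6.lean` (gate-hubbard-kl wave, t7 g9; revision 2 of F7e).
Lemma 7 of [Salmhofer1998] (p.22 L117 – p.23 L37; named fact `OverlappingLoopBound`, licence F-091) has three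
conclusions for the overlapping-loop functional `Y_{α,i}(t)` of (6.7) built on the many-fermion propagator
(5.17): (o) `Y_{α,i}(t) = 0` for `t > log(βε₀/π)`; (6.8) `Y_{α,i}(t) ≤ (8J₁)^{i-1} B_α ε_t^{i-2-|α|}`; and the
volume-improved bound (6.9) for `i ≥ 3`.  The printed proof of (o) and (6.8) is one line — "By (5.18),
`|D^α Ċ_t(p)| ≤ B_α ε_t^{-1-|α|}`, so `Y_{α,i}(t) ≤ B_α ε_t^{-1-|α|} (∫_{ℝ×𝓑} |Ĉ_t(k)| dk)^{i-1}`, and (6.8)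
follows from (5.21)" (p.23 L1–6) —; (6.9) is the overlapping-loop volume argument (6.10)–(6.14) resting on
Lemma 6 = [FST2]'s two-loop volume theorem (tree: named fact `FermiRG.VolumeBound`).  This file proves the
one-line half in the kernel:

* `lintegral_loopSet_prod` — Tonelli on the loop region `(ℝ × 𝓑)^n`: `∫ ∏_j f(k_j) = (∫ f)^n`;
* `loopY_le_mul_propL1_pow` — for any scale family with measurable `Ĉ_t(ω_β(·), ·)` and a pointwise bound
  `sup_Q |D^α Ċ_t(Q)| ≤ b`: `Y_{α,n+1}(t) ≤ b (∫|Ĉ_t|)^n` (the display between (6.9) and (6.10), p.23 L3–6);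
* `loopY_modelProp_le` — **(6.8) for the many-fermion propagator** from the displays (5.18) (at every real
  frequency) and (5.21) exactly as hypothesised in `OverlappingLoopBound`, for all `i ≥ 1`, `|α| ≤ k₀`;
  `overlappingLoopBound_68` packages it in the binder order of the named fact;
* `iterMomPartial_apply_eq_iteratedFDeriv`, `norm_multiMomPartial_le_norm_iteratedFDeriv` — F7e's coordinate
  partials `D^α` are the Fréchet derivative at coordinate vectors, so Lemma 4's `‖D^m Ḋ̂_t‖` bounds (tree
  `exists_bound_display518`, stated at `ω_β(p₀)` for arbitrary real `β` — every real frequency is such a value,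
  `exists_omegaStep_eq`) DISCHARGE the hypothesis (5.18) of `OverlappingLoopBound` at every real frequency:
  `exists_bound518_multiMomPartial`; hence **(6.8) unconditionally** (`exists_loopY_modelProp_le`) and the
  (6.8)-half of `LoopBoundsHold` for the model with `B = max(B₀, B₁, B₂)` (`exists_loopBounds68_modelProp`);
* `loopY_modelProp_eq_zero_of_log_lt` / `loopYM_modelProp_eq_zero_of_log_lt` — **(o)**: beyond
  `log(βε₀/π)` every `Y` with an integrated line vanishes (a factor `Ĉ_t(ω_β(k₀), 𝐤) = 0`, tree
  `cutoffCovInf_eq_zero_of_log_lt`), and print's functional `loopYM` ((6.7) with `Q ∈ 𝕄(β) × ℝ^d`) vanishes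
  also without one (`Ċ_t(Q₀, ·) ≡ 0` at a Matsubara `Q₀`, tree `vanishesBeyond_modelProp`, hence so do all
  its spatial derivatives); `overlappingLoopBound_o` packages it;
* `overlappingLoopBound_of_69` — consequently the named fact `OverlappingLoopBound` REDUCES to its clause
  (6.9): what licence F-091 still owes is exactly the volume-improvement bound;
* `ladderLoopHyp_modelProp` — the loop hypothesis of Theorem 3 (`LadderFourPointBound`: `Y_{0,2}(t) ≤ 8J₁B₀`
  for all `t ≥ 0`) holds for the many-fermion propagator with print's `B₀ = 4` and the `J₁` of Lemma 4 (tree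
  `exists_display521`), for every `β > 0` — no named fact involved.

Source: M. Salmhofer, Commun. Math. Phys. **194** (1998) 249–295, arXiv:cond-mat/9706188 [Salmhofer1998];
locators `p.N Ln` = chunk/line of the materialised arXiv TeX as in F7e.  No definitions, no named facts, no
sorry/axiom; nothing about the Hubbard model is asserted.
-/

noncomputable section

open MeasureTheory Filter
open scoped Topology ENNReal

namespace Literature.MathematicalPhysics.QuantumLattice.FermiRG

namespace Salmhofer1998

variable {d : ℕ}

/-! ### The loop region `(ℝ × 𝓑)^n`: Tonelli -/

/-- `((2π)^{-(d+1)})^n = (((2π)^{-(d+1)})^1)^n`. [cite: Salmhofer1998, Lemma 4 (5.20)–(5.21) (p.19 L154–164)] -/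
theorem loopWeight_eq_pow (d n : ℕ) : loopWeight d n = loopWeight d 1 ^ n := by
  simp [loopWeight]

/-- `0 ≤ ((2π)^{-(d+1)})^n`. [cite: Salmhofer1998, Lemma 4 (5.20)–(5.21) (p.19 L154–164)] -/
theorem loopWeight_nonneg (d n : ℕ) : 0 ≤ loopWeight d n := by
  unfold loopWeight; positivity

/-- **Tonelli on the loop region**: for measurable `f ≥ 0`, `∫_{(ℝ×𝓑)^n} ∏_j f(k_j) ∏_j dk_j = (∫_{ℝ×𝓑} f dk)^n`
(the step "`≤ B_α ε_t^{-1-|α|} (∫|Ĉ_t(k)| dk)^{i-1}`" of Lemma 7's proof, p.23 L3–6). [cite: Salmhofer1998, Lemma 7 proof (p.23 L1–6)] -/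
theorem lintegral_loopSet_prod (latt : ℝ) (n : ℕ) {f : FMom d → ℝ≥0∞} (hf : Measurable f) :
    ∫⁻ k in loopSet d latt n, ∏ j, f (k j) = (∫⁻ k in (Set.univ : Set ℝ) ×ˢ bzBox d latt, f k) ^ n := by
  rw [loopSet, MeasureTheory.volume_pi, Measure.restrict_pi_pi,
    Literature.Probability.Distributions.lintegral_fin_nat_prod_eq_prod _ (fun _ => f) fun _ => hf]
  simp

/-- **The estimate behind (6.8)** (p.23 L1–6): for a scale family `(C, Ċ)` with `k ↦ Ĉ_t(ω_β(k₀), 𝐤)` measurable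
and a pointwise bound `|D^α Ċ_t(Q)| ≤ b` at every `Q ∈ ℝ × ℝ^d`,
`Y_{α,n+1}(t) ≤ b · (∫_{ℝ×𝓑} dk/(2π)^{d+1} |Ĉ_t(ω_β(k₀), 𝐤)|)^n`. [cite: Salmhofer1998, Lemma 7 proof (p.23 L1–6)] -/
theorem loopY_le_mul_propL1_pow (latt β : ℝ) {C Cdot : ℝ → FMom d → ℂ} {α : Fin d → ℕ} {n : ℕ}
    {t b : ℝ} (hC : Measurable fun k : FMom d => C t (toMats β k))
    (hbd : ∀ Q : FMom d, ‖multiMomPartial α (Cdot t) Q‖ ≤ b) :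
    loopY latt β C Cdot α n t ≤ ENNReal.ofReal b * propL1 latt β C t ^ n := by
  unfold loopY
  refine iSup_le fun Q => iSup_le fun v => ?_
  have hmeas : Measurable fun k : Fin n → FMom d => ∏ j, ‖C t (toMats β (k j))‖ₑ :=
    Finset.measurable_prod _ fun j _ => (hC.comp (measurable_pi_apply j)).enorm
  calc ∫⁻ k in loopSet d latt n, ENNReal.ofReal (loopWeight d n) * (∏ j, ‖C t (toMats β (k j))‖ₑ) *
          ‖multiMomPartial α (Cdot t) ((∑ j, (if v j then (1 : ℝ) else -1) • toMats β (k j)) + Q)‖ₑ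
      ≤ ∫⁻ k in loopSet d latt n, (ENNReal.ofReal (loopWeight d n) * ENNReal.ofReal b) *
          ∏ j, ‖C t (toMats β (k j))‖ₑ := by
        refine lintegral_mono fun k => ?_
        have h1 : ‖multiMomPartial α (Cdot t) ((∑ j, (if v j then (1 : ℝ) else -1) • toMats β (k j)) + Q)‖ₑ
            ≤ ENNReal.ofReal b := by
          rw [← ofReal_norm]
          exact ENNReal.ofReal_le_ofReal (hbd _)
        calc ENNReal.ofReal (loopWeight d n) * (∏ j, ‖C t (toMats β (k j))‖ₑ) *
              ‖multiMomPartial α (Cdot t) ((∑ j, (if v j then (1 : ℝ) else -1) • toMats β (k j)) + Q)‖ₑ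
            ≤ ENNReal.ofReal (loopWeight d n) * (∏ j, ‖C t (toMats β (k j))‖ₑ) * ENNReal.ofReal b := by
              gcongr
          _ = (ENNReal.ofReal (loopWeight d n) * ENNReal.ofReal b) * ∏ j, ‖C t (toMats β (k j))‖ₑ := by
              ring
    _ = (ENNReal.ofReal (loopWeight d n) * ENNReal.ofReal b) *
          (∫⁻ k in (Set.univ : Set ℝ) ×ˢ bzBox d latt, ‖C t (toMats β k)‖ₑ) ^ n := by
        rw [lintegral_const_mul _ hmeas, lintegral_loopSet_prod latt n hC.enorm]
    _ = ENNReal.ofReal b * propL1 latt β C t ^ n := by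
        rw [propL1, mul_pow, ← ENNReal.ofReal_pow (loopWeight_nonneg d 1), ← loopWeight_eq_pow]
        ring

/-! ### The many-fermion propagator: measurability and the `α = 0` kernel bound -/

/-- `k ↦ D̂_t(k) = 𝒞_t(ω_β(k₀), E(𝐤))` is Borel measurable (a step function in `k₀`, continuous in `𝐤` away
from the origin of the `(ω, E)`-plane; `χ₁` enters through its smooth global modification `cutoffExt`).
[cite: Salmhofer1998, §5.4 (5.17) (p.19 L118–126)] -/
theorem measurable_modelProp_toMats {M : ModelData d} (hM : M.Hyp) {χ₁ : ℝ → ℝ} (hχ : IsCutoff χ₁)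
    (β t : ℝ) : Measurable fun k : FMom d => modelProp M χ₁ t (toMats β k) := by
  have hfun : (fun k : FMom d => modelProp M χ₁ t (toMats β k)) = fun k : FMom d =>
      ((cutoffExt χ₁ ((epsT M.eps0 t)⁻¹ ^ 2 * ((omegaStep β k.1) ^ 2 + (M.E k.2) ^ 2)) : ℝ) : ℂ) /
        (Complex.I * (omegaStep β k.1 : ℂ) - (M.E k.2 : ℂ)) := by
    funext k
    simp only [modelProp, toMats, covC]
    rw [cutoffExt_eq hχ (by positivity)]
  rw [hfun]
  have hω : Measurable fun k : FMom d => omegaStep β k.1 := (measurable_omegaStep β).comp measurable_fst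
  have hE : Measurable fun k : FMom d => M.E k.2 :=
    hM.contDiff_E.continuous.measurable.comp measurable_snd
  have hnum : Measurable fun k : FMom d =>
      ((cutoffExt χ₁ ((epsT M.eps0 t)⁻¹ ^ 2 * ((omegaStep β k.1) ^ 2 + (M.E k.2) ^ 2)) : ℝ) : ℂ) :=
    Complex.measurable_ofReal.comp ((contDiff_cutoffExt hχ).continuous.measurable.comp
      (measurable_const.mul ((hω.pow_const 2).add (hE.pow_const 2))))
  have hden : Measurable fun k : FMom d => Complex.I * (omegaStep β k.1 : ℂ) - (M.E k.2 : ℂ) :=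
    (measurable_const.mul (Complex.measurable_ofReal.comp hω)).sub (Complex.measurable_ofReal.comp hE)
  exact hnum.div hden

/-- `D^0 = id` on one-leg functions. [cite: Salmhofer1998, Lemma 4 (5.18) (p.19 L136–145)] -/
theorem multiMomPartial_zero (f : FMom d → ℂ) : multiMomPartial (0 : Fin d → ℕ) f = f := by
  unfold multiMomPartial
  have h : ((List.finRange d).flatMap fun ν => List.replicate ((0 : Fin d → ℕ) ν) ν) = [] := by
    simp [List.flatMap_eq_nil_iff]
  rw [h]
  rfl

/-- If a one-leg function vanishes identically in the spatial momentum at a fixed frequency `x`, so do all its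
iterated spatial partial derivatives there. [cite: Salmhofer1998, §6.3 (p.24 L84–93)] -/
theorem iterMomPartial_apply_eq_zero {f : FMom d → ℂ} {x : ℝ} (h : ∀ q : Mom d, f (x, q) = 0) :
    ∀ (l : List (Fin d)) (q : Mom d), iterMomPartial l f (x, q) = 0 := by
  intro l
  induction l with
  | nil => intro q; exact h q
  | cons ν l ih =>
      intro q
      have hfun : (fun q' : Mom d => iterMomPartial l f (x, q')) = fun _ => (0 : ℂ) := funext ih
      simp only [iterMomPartial, List.foldr_cons] at hfun ⊢
      simp [momPartial, hfun]

/-- `D^α f(x, ·) ≡ 0` whenever `f(x, ·) ≡ 0`. [cite: Salmhofer1998, §6.3 (p.24 L84–93)] -/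
theorem multiMomPartial_apply_eq_zero {f : FMom d → ℂ} {x : ℝ} (h : ∀ q : Mom d, f (x, q) = 0)
    (α : Fin d → ℕ) (q : Mom d) : multiMomPartial α f (x, q) = 0 :=
  iterMomPartial_apply_eq_zero h _ q

/-! ### Coordinate partials versus the Fréchet derivative; (5.18) at every real frequency -/

/-- Iterated coordinate partial derivatives of a `C^{|l|}` slice `𝐪 ↦ f(x, 𝐪)` are its Fréchet derivative
evaluated at the corresponding coordinate vectors: `∂_{l₁}⋯∂_{l_n} f(x, 𝐪) = D^n f(x, ·)(𝐪)[e_{l₁}, …, e_{l_n}]`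
(the sense in which Lemma 4's `‖D^m Ḋ̂_t‖` bounds contain print's `|D^α Ḋ̂_t|`).
[cite: Salmhofer1998, Lemma 4 (5.18) (p.19 L136–145)] -/
theorem iterMomPartial_apply_eq_iteratedFDeriv {f : FMom d → ℂ} {x : ℝ} :
    ∀ (l : List (Fin d)), ContDiff ℝ l.length (fun q : Mom d => f (x, q)) → ∀ q : Mom d,
      iterMomPartial l f (x, q) =
        iteratedFDeriv ℝ l.length (fun q : Mom d => f (x, q)) q (fun i => Pi.single (l.get i) (1 : ℝ)) := by
  intro l
  induction l with
  | nil =>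
      intro _ q
      simp [iterMomPartial]
  | cons ν l ih =>
      intro hf q
      have hlen : (ν :: l).length = l.length + 1 := rfl
      have hf' : ContDiff ℝ l.length (fun q : Mom d => f (x, q)) :=
        hf.of_le (by rw [hlen]; exact_mod_cast Nat.le_succ _)
      have hfun : (fun q' : Mom d => iterMomPartial l f (x, q')) = fun q' =>
          iteratedFDeriv ℝ l.length (fun q : Mom d => f (x, q)) q' (fun i => Pi.single (l.get i) (1 : ℝ)) :=
        funext (ih hf')
      have hdiff : DifferentiableAt ℝ (iteratedFDeriv ℝ l.length (fun q : Mom d => f (x, q))) q := by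
        refine (hf.differentiable_iteratedFDeriv ?_) q
        rw [hlen]; exact_mod_cast Nat.lt_succ_self _
      have htup : (fun i : Fin (ν :: l).length => (Pi.single ((ν :: l).get i) (1 : ℝ) : Mom d)) =
          Fin.cons (Pi.single ν (1 : ℝ)) (fun i => Pi.single (l.get i) (1 : ℝ)) := by
        funext i
        refine Fin.cases ?_ (fun j => ?_) i
        · rfl
        · rfl
      show momPartial ν (iterMomPartial l f) (x, q) =
        iteratedFDeriv ℝ (l.length + 1) (fun q : Mom d => f (x, q)) q
          (fun i : Fin (ν :: l).length => (Pi.single ((ν :: l).get i) (1 : ℝ) : Mom d))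
      rw [htup, iteratedFDeriv_succ_apply_left, Fin.cons_zero, Fin.tail_cons]
      simp only [momPartial]
      rw [hfun]
      have happ := ((ContinuousMultilinearMap.apply ℝ (fun _ : Fin l.length => Mom d) ℂ
        (fun i => Pi.single (l.get i) (1 : ℝ))).hasFDerivAt.comp q hdiff.hasFDerivAt).fderiv
      simp only [Function.comp_def, ContinuousMultilinearMap.apply_apply] at happ
      rw [happ]
      rfl

/-- `|D^α f(x, 𝐩)| ≤ ‖D^{|α|}_𝐩 f(x, ·)(𝐩)‖` for a `C^{|α|}` slice (operator norm of the Fréchet derivative; tree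
`norm_iteratedFDeriv_apply_coord_le`). [cite: Salmhofer1998, Lemma 4 (5.18) (p.19 L136–145)] -/
theorem norm_multiMomPartial_le_norm_iteratedFDeriv {f : FMom d → ℂ} {x : ℝ} (α : Fin d → ℕ)
    (hf : ContDiff ℝ (miDeg α) (fun q : Mom d => f (x, q))) (p : Mom d) :
    ‖multiMomPartial α f (x, p)‖ ≤ ‖iteratedFDeriv ℝ (miDeg α) (fun q : Mom d => f (x, q)) p‖ := by
  set l : List (Fin d) := (List.finRange d).flatMap fun ν => List.replicate (α ν) ν with hl
  have hL : l.length = miDeg α := by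
    simp [hl, miDeg, List.length_flatMap, Fin.sum_univ_def]
  have hf' : ContDiff ℝ l.length (fun q : Mom d => f (x, q)) := by rw [hL]; exact hf
  have key : multiMomPartial α f (x, p) =
      iteratedFDeriv ℝ l.length (fun q : Mom d => f (x, q)) p (fun i => Pi.single (l.get i) (1 : ℝ)) :=
    iterMomPartial_apply_eq_iteratedFDeriv l hf' p
  have h := norm_iteratedFDeriv_apply_coord_le (fun q : Mom d => f (x, q)) p (fun i => l.get i)
  rw [← key] at h
  rw [hL] at h
  exact h

/-- Every real number is a value of some step function `ω_β` (`β = π/x`, `p₀ = x`; `β = 0` for `x = 0`): the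
device by which the tree's (5.18), stated at `ω_β(p₀)` for arbitrary real `β`, yields the kernel bound at every
real frequency (audit item 8 of F7e). [cite: Salmhofer1998, §5.4 (5.13) (p.19 L93–98)] -/
theorem exists_omegaStep_eq (x : ℝ) : ∃ β p₀ : ℝ, omegaStep β p₀ = x := by
  rcases eq_or_ne x 0 with rfl | hx
  · exact ⟨0, 0, by simp [omegaStep, matsFreq]⟩
  · refine ⟨Real.pi / x, x, ?_⟩
    have hπ := Real.pi_pos
    have h1 : Real.pi / x * x / (2 * Real.pi) = 1 / 2 := by
      field_simp
    have h2 : ⌈Real.pi / x * x / (2 * Real.pi)⌉ = 1 := by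
      rw [h1]; norm_num
    simp only [omegaStep, matsFreq, h2]
    push_cast
    field_simp
    ring

/-- **(5.18) at every real frequency, in coordinate form** — the hypothesis shape `h518` of `OverlappingLoopBound`,
DISCHARGED for the many-fermion propagator from Lemma 4 (tree `exists_bound_display518`, `B₀ = 4`): for all
`t ≥ 0`, `|α| ≤ k₀`, all real `x` and all `𝐩`,
`|D^α Ċ_t(x, 𝐩)| ≤ B_{|α|} ε_t^{-1-|α|} 1(|x| ≤ ε_t) 1(|E(𝐩)| ≤ ε_t)`.
[cite: Salmhofer1998, Lemma 4 (5.18) (p.19 L136–146); proof p.20 L4–13] -/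
theorem exists_bound518_multiMomPartial {M : ModelData d} (hM : M.Hyp) {χ₁ : ℝ → ℝ} (hχ : IsCutoff χ₁) :
    ∃ B : ℕ → ℝ, B 0 = 4 ∧ (∀ m, 0 < B m) ∧
      ∀ t : ℝ, 0 ≤ t → ∀ α : Fin d → ℕ, miDeg α ≤ M.k0 → ∀ (x : ℝ) (p : Mom d),
        ‖multiMomPartial α (modelPropDot M χ₁ t) (x, p)‖ ≤
          B (miDeg α) * (epsT M.eps0 t)⁻¹ ^ (1 + miDeg α) *
            (if |x| ≤ epsT M.eps0 t then 1 else 0) * (if |M.E p| ≤ epsT M.eps0 t then 1 else 0) := by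
  obtain ⟨B, hB0, hBpos, h⟩ := exists_bound_display518 hM hχ
  refine ⟨B, hB0, hBpos, fun t ht α hα x p => ?_⟩
  obtain ⟨β, p₀, hx⟩ := exists_omegaStep_eq x
  obtain ⟨h1, h2⟩ := h (miDeg α) hα β t ht p₀ p
  have hslice : (fun q : Mom d => modelPropDot M χ₁ t (x, q)) =
      fun q : Mom d => deriv (fun s : ℝ => cutoffCovInf M χ₁ β s p₀ q) t := by
    funext q
    rw [deriv_cutoffCovInf, hx]
    rfl
  have hcd : ContDiff ℝ (miDeg α) (fun q : Mom d => modelPropDot M χ₁ t (x, q)) := by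
    rw [hslice]
    exact (contDiff_deriv_cutoffCovInf_snd hM hχ β t p₀).of_le (by exact_mod_cast hα)
  rw [hx] at h1 h2
  calc ‖multiMomPartial α (modelPropDot M χ₁ t) (x, p)‖
      ≤ ‖iteratedFDeriv ℝ (miDeg α) (fun q : Mom d => modelPropDot M χ₁ t (x, q)) p‖ :=
        norm_multiMomPartial_le_norm_iteratedFDeriv α hcd p
    _ = ‖iteratedFDeriv ℝ (miDeg α) (fun q : Mom d => deriv (fun s : ℝ => cutoffCovInf M χ₁ β s p₀ q) t) p‖ := by
        rw [hslice]
    _ ≤ B (miDeg α) * (epsT M.eps0 t)⁻¹ ^ (miDeg α + 1) *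
          ((if |x| ≤ epsT M.eps0 t then (1 : ℝ) else 0) * (if |M.E p| ≤ epsT M.eps0 t then (1 : ℝ) else 0)) :=
        h1.trans h2
    _ = B (miDeg α) * (epsT M.eps0 t)⁻¹ ^ (1 + miDeg α) *
            (if |x| ≤ epsT M.eps0 t then 1 else 0) * (if |M.E p| ≤ epsT M.eps0 t then 1 else 0) := by
        rw [add_comm (miDeg α) 1]; ring

/-! ### Lemma 7 (6.8) for the many-fermion propagator -/

/-- **Lemma 7, (6.8), for the many-fermion propagator (5.17)** — PROVED from the two displays its printed proof
invokes: (5.18) (`|D^α Ċ_t(x, 𝐩)| ≤ B_α ε_t^{-1-|α|} 1(|x| ≤ ε_t) 1(|E(𝐩)| ≤ ε_t)` at every real frequency `x`)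
and (5.21) (`∫ |Ĉ_t| ≤ 8J₁ε_t`, `Display521`): for all `t ≥ 0`, `|α| ≤ k₀`, `i ≥ 1`,
`Y_{α,i}(t) ≤ (8J₁)^{i-1} B_α ε_t^{i-2-|α|}` — on the all-real-`Q` functional `loopY` (hence also on print's
`loopYM`, `loopYM_le_loopY`).  "By (5.18) … so `Y ≤ B_α ε_t^{-1-|α|} (∫|Ĉ_t|)^{i-1}`, and (6.8) follows from
(5.21)." [cite: Salmhofer1998, Lemma 7 (6.8) (p.22 L119–122), proof p.23 L1–6] -/
theorem loopY_modelProp_le {M : ModelData d} (hM : M.Hyp) {χ₁ : ℝ → ℝ} (hχ : IsCutoff χ₁)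
    {B : (Fin d → ℕ) → ℝ} {J₁ β : ℝ} (hB : ∀ α, 0 ≤ B α) (hJ : 0 ≤ J₁)
    (h518 : ∀ t : ℝ, 0 ≤ t → ∀ α : Fin d → ℕ, miDeg α ≤ M.k0 → ∀ (x : ℝ) (p : Mom d),
        ‖multiMomPartial α (modelPropDot M χ₁ t) (x, p)‖ ≤
          B α * (epsT M.eps0 t)⁻¹ ^ (1 + miDeg α) *
            (if |x| ≤ epsT M.eps0 t then 1 else 0) * (if |M.E p| ≤ epsT M.eps0 t then 1 else 0))
    (h521 : ∀ t : ℝ, 0 ≤ t → Display521 M χ₁ β J₁ t)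
    {t : ℝ} (ht : 0 ≤ t) {α : Fin d → ℕ} (hα : miDeg α ≤ M.k0) {i : ℕ} (hi : 1 ≤ i) :
    loopY M.latt β (modelProp M χ₁) (modelPropDot M χ₁) α (i - 1) t ≤
      ENNReal.ofReal ((8 * J₁) ^ (i - 1) * B α * epsT M.eps0 t ^ ((i : ℤ) - 2 - (miDeg α : ℤ))) := by
  have hε := epsT_pos hM.eps0_pos t
  set b : ℝ := B α * (epsT M.eps0 t)⁻¹ ^ (1 + miDeg α) with hb
  have hb0 : 0 ≤ b := mul_nonneg (hB α) (by positivity)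
  have hpt : ∀ Q : FMom d, ‖multiMomPartial α (modelPropDot M χ₁ t) Q‖ ≤ b := by
    intro Q
    refine (h518 t ht α hα Q.1 Q.2).trans ?_
    have h1 : (if |Q.1| ≤ epsT M.eps0 t then (1 : ℝ) else 0) ≤ 1 := by split_ifs <;> norm_num
    have h2 : (if |M.E Q.2| ≤ epsT M.eps0 t then (1 : ℝ) else 0) ≤ 1 := by split_ifs <;> norm_num
    have h3 : (0 : ℝ) ≤ (if |Q.1| ≤ epsT M.eps0 t then (1 : ℝ) else 0) := by split_ifs <;> norm_num
    have h4 : (0 : ℝ) ≤ (if |M.E Q.2| ≤ epsT M.eps0 t then (1 : ℝ) else 0) := by split_ifs <;> norm_num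
    calc b * (if |Q.1| ≤ epsT M.eps0 t then (1 : ℝ) else 0) * (if |M.E Q.2| ≤ epsT M.eps0 t then (1 : ℝ) else 0)
        ≤ b * 1 * 1 := by gcongr
      _ = b := by ring
  have hL : propL1 M.latt β (modelProp M χ₁) t ≤ ENNReal.ofReal (8 * J₁ * epsT M.eps0 t) := by
    rw [propL1_modelProp]; exact h521 t ht
  calc loopY M.latt β (modelProp M χ₁) (modelPropDot M χ₁) α (i - 1) t
      ≤ ENNReal.ofReal b * propL1 M.latt β (modelProp M χ₁) t ^ (i - 1) :=
        loopY_le_mul_propL1_pow _ _ (measurable_modelProp_toMats hM hχ β t) hpt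
    _ ≤ ENNReal.ofReal b * ENNReal.ofReal (8 * J₁ * epsT M.eps0 t) ^ (i - 1) := by gcongr
    _ = ENNReal.ofReal (b * (8 * J₁ * epsT M.eps0 t) ^ (i - 1)) := by
        rw [← ENNReal.ofReal_pow (by positivity), ← ENNReal.ofReal_mul hb0]
    _ = ENNReal.ofReal ((8 * J₁) ^ (i - 1) * B α * epsT M.eps0 t ^ ((i : ℤ) - 2 - (miDeg α : ℤ))) := by
        congr 1
        have key : (epsT M.eps0 t)⁻¹ ^ (1 + miDeg α) * epsT M.eps0 t ^ (i - 1) =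
            epsT M.eps0 t ^ ((i : ℤ) - 2 - (miDeg α : ℤ)) := by
          rw [inv_pow, ← zpow_natCast (epsT M.eps0 t) (1 + miDeg α), ← zpow_neg,
            ← zpow_natCast (epsT M.eps0 t) (i - 1), ← zpow_add₀ hε.ne']
          congr 1
          push_cast [Nat.cast_sub hi]
          ring
        calc b * (8 * J₁ * epsT M.eps0 t) ^ (i - 1)
            = (8 * J₁) ^ (i - 1) * B α * ((epsT M.eps0 t)⁻¹ ^ (1 + miDeg α) * epsT M.eps0 t ^ (i - 1)) := by
              rw [hb, mul_pow]; ring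
          _ = (8 * J₁) ^ (i - 1) * B α * epsT M.eps0 t ^ ((i : ℤ) - 2 - (miDeg α : ℤ)) := by rw [key]

/-- **The (6.8) clause of `OverlappingLoopBound`, proved**, in the binder order of the named fact (so that a
discharger of licence F-091 obtains it by `exact overlappingLoopBound_68 …`).
[cite: Salmhofer1998, Lemma 7 (6.8) (p.22 L119–122)] -/
theorem overlappingLoopBound_68 (d : ℕ) (M : ModelData d) (_hd : 2 ≤ d) (hM : M.Hyp) (_hk : d < M.k0)
    (χ₁ : ℝ → ℝ) (hχ : IsCutoff χ₁) (B : (Fin d → ℕ) → ℝ) (J₁ : ℝ) (hB : ∀ α, 0 ≤ B α) (hJ : 0 < J₁)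
    (h518 : ∀ β : ℝ, 0 < β → 6 ≤ β * M.eps0 → ∀ t : ℝ, 0 ≤ t → ∀ α : Fin d → ℕ, miDeg α ≤ M.k0 →
      ∀ (x : ℝ) (p : Mom d),
        ‖multiMomPartial α (modelPropDot M χ₁ t) (x, p)‖ ≤
          B α * (epsT M.eps0 t)⁻¹ ^ (1 + miDeg α) *
            (if |x| ≤ epsT M.eps0 t then 1 else 0) * (if |M.E p| ≤ epsT M.eps0 t then 1 else 0))
    (h521 : ∀ β : ℝ, 0 < β → 6 ≤ β * M.eps0 → ∀ t : ℝ, 0 ≤ t → Display521 M χ₁ β J₁ t) :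
    ∀ β : ℝ, 0 < β → 6 ≤ β * M.eps0 → ∀ t : ℝ, 0 ≤ t → ∀ α : Fin d → ℕ, miDeg α ≤ M.k0 →
      ∀ i : ℕ, 1 ≤ i →
        loopY M.latt β (modelProp M χ₁) (modelPropDot M χ₁) α (i - 1) t ≤
          ENNReal.ofReal ((8 * J₁) ^ (i - 1) * B α * epsT M.eps0 t ^ ((i : ℤ) - 2 - (miDeg α : ℤ))) :=
  fun β hβ hβε _t ht _α hα _i hi =>
    loopY_modelProp_le hM hχ hB hJ.le (h518 β hβ hβε) (h521 β hβ hβε) ht hα hi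

/-- **Lemma 7 (6.8) for the many-fermion propagator, UNCONDITIONALLY** (the constants `B_m` (`B₀ = 4`) and `J₁`
of Lemma 4, tree `exists_bound_display518` / `exists_display521`): for every `β > 0`, `t ≥ 0`, `|α| ≤ k₀`,
`i ≥ 1`, `Y_{α,i}(t) ≤ (8J₁)^{i-1} B_{|α|} ε_t^{i-2-|α|}`.  No named fact is used.
[cite: Salmhofer1998, Lemma 7 (6.8) (p.22 L119–122)] -/
theorem exists_loopY_modelProp_le {M : ModelData d} (hM : M.Hyp) {χ₁ : ℝ → ℝ} (hχ : IsCutoff χ₁) :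
    ∃ (B : ℕ → ℝ) (J₁ : ℝ), B 0 = 4 ∧ (∀ m, 0 < B m) ∧ 0 < J₁ ∧
      ∀ β : ℝ, 0 < β → ∀ t : ℝ, 0 ≤ t → ∀ α : Fin d → ℕ, miDeg α ≤ M.k0 → ∀ i : ℕ, 1 ≤ i →
        loopY M.latt β (modelProp M χ₁) (modelPropDot M χ₁) α (i - 1) t ≤
          ENNReal.ofReal ((8 * J₁) ^ (i - 1) * B (miDeg α) *
            epsT M.eps0 t ^ ((i : ℤ) - 2 - (miDeg α : ℤ))) := by
  obtain ⟨B, hB0, hBpos, h518⟩ := exists_bound518_multiMomPartial hM hχ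
  obtain ⟨J₁, hJ, -, h521⟩ := exists_display521 hM hχ
  refine ⟨B, J₁, hB0, hBpos, hJ, fun β hβ t ht α hα i hi => ?_⟩
  exact loopY_modelProp_le hM hχ (B := fun α => B (miDeg α)) (fun α => (hBpos _).le) hJ.le h518
    (h521 β hβ) ht hα hi

/-- **The (6.8)-half of `LoopBoundsHold` for the many-fermion propagator, proved**: with `B = max(B₀, B₁, B₂)`
and the `J₁` of Lemma 4, for every `β > 0`: `Y_{α,i}(t) ≤ (8J₁)^{i-1} B ε_t^{i-2-|α|}` for all `t ≥ 0`, `|α| ≤ 2`,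
`i ≥ 1` (the first conjunct of the hypothesis of Theorems 4–7; the second, (6.9), is Lemma 7's volume-improved
clause). [cite: Salmhofer1998, Lemma 7 (6.8) (p.22 L119–122) and Theorem 6 (p.24 L115)] -/
theorem exists_loopBounds68_modelProp {M : ModelData d} (hM : M.Hyp) {χ₁ : ℝ → ℝ} (hχ : IsCutoff χ₁) :
    ∃ B J₁ : ℝ, 0 < B ∧ 0 < J₁ ∧ ∀ β : ℝ, 0 < β →
      ∀ t : ℝ, 0 ≤ t → ∀ α : Fin d → ℕ, miDeg α ≤ 2 → ∀ i : ℕ, 1 ≤ i →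
        loopY M.latt β (modelProp M χ₁) (modelPropDot M χ₁) α (i - 1) t ≤
          ENNReal.ofReal ((8 * J₁) ^ (i - 1) * B * epsT M.eps0 t ^ ((i : ℤ) - 2 - (miDeg α : ℤ))) := by
  obtain ⟨B, J₁, -, hBpos, hJ, h⟩ := exists_loopY_modelProp_le hM hχ
  refine ⟨max (B 0) (max (B 1) (B 2)), J₁, lt_max_of_lt_left (hBpos 0), hJ,
    fun β hβ t ht α hα i hi => ?_⟩
  have hk : miDeg α ≤ M.k0 := hα.trans hM.two_le_k0
  refine (h β hβ t ht α hk i hi).trans (ENNReal.ofReal_le_ofReal ?_)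
  have hε := epsT_pos hM.eps0_pos t
  have hBle : B (miDeg α) ≤ max (B 0) (max (B 1) (B 2)) := by
    rcases Nat.lt_or_ge (miDeg α) 1 with h0 | h1
    · rw [show miDeg α = 0 by omega]; exact le_max_left _ _
    · rcases Nat.lt_or_ge (miDeg α) 2 with h1' | h2
      · rw [show miDeg α = 1 by omega]; exact le_max_of_le_right (le_max_left _ _)
      · rw [show miDeg α = 2 by omega]; exact le_max_of_le_right (le_max_right _ _)
  have h1 : 0 ≤ (8 * J₁) ^ (i - 1) := by positivity
  have h2 : 0 < epsT M.eps0 t ^ ((i : ℤ) - 2 - (miDeg α : ℤ)) := zpow_pos hε _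
  calc (8 * J₁) ^ (i - 1) * B (miDeg α) * epsT M.eps0 t ^ ((i : ℤ) - 2 - (miDeg α : ℤ))
      = (8 * J₁) ^ (i - 1) * epsT M.eps0 t ^ ((i : ℤ) - 2 - (miDeg α : ℤ)) * B (miDeg α) := by ring
    _ ≤ (8 * J₁) ^ (i - 1) * epsT M.eps0 t ^ ((i : ℤ) - 2 - (miDeg α : ℤ)) * max (B 0) (max (B 1) (B 2)) :=
        mul_le_mul_of_nonneg_left hBle (mul_nonneg h1 h2.le)
    _ = (8 * J₁) ^ (i - 1) * max (B 0) (max (B 1) (B 2)) *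
          epsT M.eps0 t ^ ((i : ℤ) - 2 - (miDeg α : ℤ)) := by ring

/-! ### Lemma 7 (o) for the many-fermion propagator -/

/-- **Lemma 7 (o), integrated lines**: for `t > log(βε₀/π)` every `Y` with at least one integrated line
vanishes — already on the all-real-`Q` functional `loopY` — because each factor `Ĉ_t(ω_β(k₀), 𝐤)` is zero
(Lemma 4; tree `cutoffCovInf_eq_zero_of_log_lt`). [cite: Salmhofer1998, Lemma 7 (p.22 L117–118) and Lemma 4 (p.19 L133–135)] -/
theorem loopY_modelProp_eq_zero_of_log_lt (M : ModelData d) (hM : M.Hyp) {χ₁ : ℝ → ℝ} (hχ : IsCutoff χ₁)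
    {β : ℝ} (hβ : 0 < β) {t : ℝ} (ht : Real.log (β * M.eps0 / Real.pi) < t) (α : Fin d → ℕ) {n : ℕ}
    (hn : 1 ≤ n) : loopY M.latt β (modelProp M χ₁) (modelPropDot M χ₁) α n t = 0 := by
  have hprod : ∀ k : Fin n → FMom d, (∏ j, ‖modelProp M χ₁ t (toMats β (k j))‖ₑ) = 0 := by
    intro k
    refine Finset.prod_eq_zero (Finset.mem_univ (⟨0, hn⟩ : Fin n)) ?_
    rw [modelProp_toMats, cutoffCovInf_eq_zero_of_log_lt M hχ hM.eps0_pos hβ ht, enorm_zero]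
  unfold loopY
  simp [hprod]

/-- **Lemma 7 (o) as printed** — on print's functional `loopYM` ((6.7), `Q ∈ 𝕄(β) × ℝ^d`): for `t > log(βε₀/π)`,
`Y_{α,i}(t) = 0` for every multi-index and every `i ≥ 1`.  Without an integrated line (`i = 1`) the argument
of `D^α Ċ_t` has a Matsubara frequency `Q₀`, `|Q₀| ≥ π/β > ε_t`, so `Ċ_t(Q₀, ·) ≡ 0` (tree
`vanishesBeyond_modelProp`) together with all its spatial derivatives. [cite: Salmhofer1998, Lemma 7 (p.22 L117–118)] -/
theorem loopYM_modelProp_eq_zero_of_log_lt (M : ModelData d) (hM : M.Hyp) {χ₁ : ℝ → ℝ} (hχ : IsCutoff χ₁)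
    {β : ℝ} (hβ : 0 < β) {t : ℝ} (ht : Real.log (β * M.eps0 / Real.pi) < t) (α : Fin d → ℕ) (n : ℕ) :
    loopYM M.latt β (modelProp M χ₁) (modelPropDot M χ₁) α n t = 0 := by
  rcases Nat.eq_zero_or_pos n with rfl | hn
  · -- no integrated line: the argument is `(matsFreq β n', q)` itself
    have hzero : ∀ (n' : ℤ) (q : Mom d),
        multiMomPartial α (modelPropDot M χ₁ t) (matsFreq β n', q) = 0 := fun n' q =>
      multiMomPartial_apply_eq_zero (fun q' => ((vanishesBeyond_modelProp M hM hχ hβ) t ht n' q').2) α q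
    unfold loopYM
    simp [hzero]
  · exact le_antisymm ((loopYM_le_loopY _ _ _ _ _ _ _).trans
      (loopY_modelProp_eq_zero_of_log_lt M hM hχ hβ ht α hn).le) bot_le

/-- **The (o) clause of `OverlappingLoopBound`, proved**, in the binder order of the named fact.
[cite: Salmhofer1998, Lemma 7 (p.22 L117–118)] -/
theorem overlappingLoopBound_o (d : ℕ) (M : ModelData d) (hM : M.Hyp) (χ₁ : ℝ → ℝ) (hχ : IsCutoff χ₁) :
    ∀ β : ℝ, 0 < β → 6 ≤ β * M.eps0 → ∀ t : ℝ, Real.log (β * M.eps0 / Real.pi) < t →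
      ∀ (α : Fin d → ℕ) (n : ℕ), loopYM M.latt β (modelProp M χ₁) (modelPropDot M χ₁) α n t = 0 :=
  fun _β hβ _ _t ht α n => loopYM_modelProp_eq_zero_of_log_lt M hM hχ hβ ht α n

/-- **`OverlappingLoopBound` reduces to its clause (6.9).**  Given, for every model of the §2.3 class, cutoff and
constants as in the named fact, the volume-improved bound (6.9) with a `β`-independent `K₀` — the content of
(6.10)–(6.14) and Lemma 6 — the named fact F-091 follows, its clauses (o) and (6.8) being theorems
(`overlappingLoopBound_o`, `overlappingLoopBound_68`).  No new fact: the (6.9) statement is a hypothesis of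
this theorem, spelled out. [cite: Salmhofer1998, Lemma 7 (p.22 L117 – p.23 L37)] -/
theorem overlappingLoopBound_of_69
    (h69 : ∀ (d : ℕ) (M : ModelData d), 2 ≤ d → M.Hyp → d < M.k0 →
      ∀ (χ₁ : ℝ → ℝ), IsCutoff χ₁ →
      ∀ (B : (Fin d → ℕ) → ℝ) (J₁ : ℝ), (∀ α, 0 ≤ B α) → 0 < J₁ →
        (∀ β : ℝ, 0 < β → 6 ≤ β * M.eps0 → ∀ t : ℝ, 0 ≤ t → ∀ α : Fin d → ℕ, miDeg α ≤ M.k0 →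
          ∀ (x : ℝ) (p : Mom d),
            ‖multiMomPartial α (modelPropDot M χ₁ t) (x, p)‖ ≤
              B α * (epsT M.eps0 t)⁻¹ ^ (1 + miDeg α) *
                (if |x| ≤ epsT M.eps0 t then 1 else 0) * (if |M.E p| ≤ epsT M.eps0 t then 1 else 0)) →
        (∀ β : ℝ, 0 < β → 6 ≤ β * M.eps0 → ∀ t : ℝ, 0 ≤ t → Display521 M χ₁ β J₁ t) →
        ∃ K₀ : ℝ, 0 < K₀ ∧
          ∀ β : ℝ, 0 < β → 6 ≤ β * M.eps0 → ∀ t : ℝ, 0 ≤ t → ∀ α : Fin d → ℕ, miDeg α ≤ M.k0 →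
            ∀ i : ℕ, 3 ≤ i →
              loopY M.latt β (modelProp M χ₁) (modelPropDot M χ₁) α (i - 1) t ≤
                ENNReal.ofReal ((8 * J₁) ^ (i - 1) * B α * K₀ * twoLoopFactor d t *
                  epsT M.eps0 t ^ ((i : ℤ) - 1 - (miDeg α : ℤ)))) :
    OverlappingLoopBound :=
  fun d M hd hM hk χ₁ hχ B J₁ hB hJ h518 h521 =>
    ⟨overlappingLoopBound_o d M hM χ₁ hχ,
      overlappingLoopBound_68 d M hd hM hk χ₁ hχ B J₁ hB hJ h518 h521,
      h69 d M hd hM hk χ₁ hχ B J₁ hB hJ h518 h521⟩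

/-! ### Theorem 3's loop hypothesis for the many-fermion propagator -/

/-- **The loop hypothesis of Theorem 3 holds for the many-fermion propagator**: with print's `B₀ = 4` ((5.18) at
`α = 0`, tree `norm_covCDot_le`) and the `J₁` of Lemma 4 (tree `exists_display521`), for every `β > 0` and
`t ≥ 0`, `Y_{0,2}(t) ≤ 8J₁B₀` — the input "(6.15) with `i = 2` and `α = 0`" of Theorem 3's proof (p.24 L8–10),
in the exact shape hypothesised by `LadderFourPointBound`; no named fact is used.
[cite: Salmhofer1998, Theorem 3 proof (p.24 L8–10) and Lemma 7 (6.8) (p.22 L119–122)] -/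
theorem ladderLoopHyp_modelProp {M : ModelData d} (hM : M.Hyp) {χ₁ : ℝ → ℝ} (hχ : IsCutoff χ₁) :
    ∃ J₁ : ℝ, 0 < J₁ ∧ ∀ β : ℝ, 0 < β → ∀ t : ℝ, 0 ≤ t →
      loopY M.latt β (modelProp M χ₁) (modelPropDot M χ₁) (0 : Fin d → ℕ) 1 t ≤
        ENNReal.ofReal (8 * J₁ * 4) := by
  obtain ⟨J₁, hJ, -, h521⟩ := exists_display521 hM hχ
  refine ⟨J₁, hJ, fun β hβ t ht => ?_⟩
  have hε := epsT_pos hM.eps0_pos t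
  have hpt : ∀ Q : FMom d, ‖multiMomPartial 0 (modelPropDot M χ₁ t) Q‖ ≤ 4 * (epsT M.eps0 t)⁻¹ := by
    intro Q
    rw [multiMomPartial_zero]
    refine (norm_covCDot_le hχ hM.eps0_pos t Q.1 (M.E Q.2)).trans ?_
    have hi0 : (0 : ℝ) ≤ 4 * (epsT M.eps0 t)⁻¹ := by positivity
    split_ifs <;> nlinarith
  calc loopY M.latt β (modelProp M χ₁) (modelPropDot M χ₁) 0 1 t
      ≤ ENNReal.ofReal (4 * (epsT M.eps0 t)⁻¹) * propL1 M.latt β (modelProp M χ₁) t ^ 1 :=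
        loopY_le_mul_propL1_pow _ _ (measurable_modelProp_toMats hM hχ β t) hpt
    _ ≤ ENNReal.ofReal (4 * (epsT M.eps0 t)⁻¹) * ENNReal.ofReal (8 * J₁ * epsT M.eps0 t) := by
        have h := h521 β hβ t ht
        unfold Display521 at h
        rw [pow_one, propL1_modelProp]
        gcongr
    _ = ENNReal.ofReal (8 * J₁ * 4) := by
        rw [← ENNReal.ofReal_mul (by positivity)]
        congr 1
        field_simp

end Salmhofer1998

end Literature.MathematicalPhysics.QuantumLattice.FermiRG
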